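import Summits.BirchSwinnertonDyer.BirchSwinnertonDyer.Theorems.ByReductionTypeAtTwoGoodOrdinaryRankZeroOfMissingLowerBound
import Summits.BirchSwinnertonDyer.BirchSwinnertonDyer.Theorems.ByReductionTypeAtTwoOrdMissingLowerBoundDefs
import HarnessLib

/-!
# Route ByReductionTypeAtTwo — GLUE with the NAMED descent-inequality child (seat bsd-2adic-ord-3 GEN 2;
# planner rider K-6, edit-only shape)

THEOREM ONLY; nothing asserted; closes nothing by itself. The glue
`goodOrdinaryRankZeroAtTwo_of_katoHalf_of_missingLowerBound` (p429699) restated with its third binder the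
closed leaf constant `Theorems.OrdHalvesAtTwo.OrdMissingLowerBoundAtTwo` (p429628), which the re-split child
item will alias — so the route's `closes`/glue certificate is `fun hP hK hL => … hP hK hL` verbatim.
[Kato 2004 Thm. 17.4; Greenberg 1999 Thm. 4.1; Miller 2011 Def. 1.1.]
-/

set_option autoImplicit false

namespace Summit.BirchSwinnertonDyer.BirchSwinnertonDyer.Theorems

/-- **GLUE (rider K-6, named binders).** `OrdPublishedInputsAtTwo → OrdKatoHalfAtTwo →
OrdMissingLowerBoundAtTwo → GoodOrdinaryRankZeroAtTwo` (first two and the conclusion: route decls of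
`Theses.ByReductionTypeAtTwo`; third: the Theses-free leaf constant, by `Iff.rfl` the child's text).
[cite: Kato2004Asterisque, Thm. 17.4 (1)(2) (p. 273)] [cite: Miller2011LMS, Def. 1.1] -/
theorem goodOrdinaryRankZeroAtTwo_of_katoHalf_of_ordMissingLowerBoundAtTwo
    (hpub : Summit.BirchSwinnertonDyer.BirchSwinnertonDyer.Theses.ByReductionTypeAtTwo.OrdPublishedInputsAtTwo)
    (hK : Summit.BirchSwinnertonDyer.BirchSwinnertonDyer.Theses.ByReductionTypeAtTwo.OrdKatoHalfAtTwo)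
    (hL : Summit.BirchSwinnertonDyer.BirchSwinnertonDyer.Theorems.OrdHalvesAtTwo.OrdMissingLowerBoundAtTwo) :
    Summit.BirchSwinnertonDyer.BirchSwinnertonDyer.Theses.ByReductionTypeAtTwo.GoodOrdinaryRankZeroAtTwo :=
  goodOrdinaryRankZeroAtTwo_of_katoHalf_of_missingLowerBound hpub hK hL

end Summit.BirchSwinnertonDyer.BirchSwinnertonDyer.Theorems
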